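import Summits.QuantumFields.BalabanUV.T4Continuum.Support.StarCarrierTwoLevelIdentity
import Summits.QuantumFields.BalabanUV.T4Continuum.Support.StarCarrierNeumannPairing
import Summits.QuantumFields.BalabanUV.T4Continuum.Support.RegionElectricDictionary

/-!
# T⁴ programme, spine node NE2 (U1a), sub-row Δ1 «NE2⁰-Dirichlet» — THE NEUMANN HESSIAN JUNCTION OF (P-gaffney): P3's diagonal
# Neumann energy `hessN` of a zero-extended component IS the `ν`-row part of `‖W_ν v‖²`, and P4b's identity in P3's `bmask` letters

NE2 formalisation swarm `b2b-balaban-t4-ne2-formalise-*`, LEAF PROVER 01 (gen 10), file P4c of leaf-03-g8's item «W3-GAFFNEY-PAIRING»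
= (P-gaffney) (owner R35 (c) / R40 (a); leaf-03-g8's P5 consumption list `CLAIMS.log` 2026-08-20 l.23066, item (iii); INTENT l.23259).
On P4a `StarCarrierComponents` (p239836), P4b `StarCarrierTwoLevelIdentity` (p240587), leaf-03-g8's P3 `StarCarrierNeumannPairing`
(p240386) and leaf-02-g8's dictionary `RegionElectricDictionary` (p240511) — all BY NAME, nothing restated.

 * §1 **`neuSt_zext_eq (hH : AtMostOneNeighbour (R·N) M S)`**: at a site `x` of the fine star carrier `T′_ν`, P3's Neumann stencil of the
   zero-extended component `z′_ν = zext (R·N) M S ν v` is the `(x, ν)` entry of leaf-02-g8's directional operator, `neuSt z′_ν x =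
   (Wdir (R·N) M S ν *ᵥ v) (x, ν)` — P4a's `Wdir_mulVec_apply_self` / `Pneu_mulVec` with the bond masks `χ_ν(x)`, `χ_ν(x − e_ν)` read as
   P3's `[T′(x + e_ν)]`, `[T′(x − e_ν)]` by P4b's `chi_eq_ite_starSite`.
 * §2 **`hessN_zext_eq`** — `hessN N R M S ν z′_ν = Σ_{b : star bonds, b.2 = ν} ‖(Wdir ν v) b‖²` (leaf-02-g8's re-indexing
   `sum_starSite_eq`) — hence **`hessN_zext_le (hH) : hessN N R M S ν z′_ν ≤ nsq (Wdir (R·N) M S ν *ᵥ v)`** and the box instance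
   **`hessN_zext_le_box (hS : IsCoordBox M S) (hRN : 2 ≤ R·N)`**: item (iii) of l.23066 — the Neumann Hessian budget of P3's
   `neumann_pairing_le` is a sub-sum of the (R-loc) Hessian `Σ_μ nsq (Wdir μ *ᵥ v)` of leaf-02-g8's `RegionLocalBudgets.hRH_box`.
 * §2b **`sum_nsq_zext_eq`** `Σ_ν nsq (zext ν v) = nsq v` and **`nsq_zext_le`** (item (iv) of l.23066).
 * §3 **`first_order_identity_bmask`** / **`first_order_identity_lev_bmask`**: P4b's `first_order_identity_ite` / `_lev_ite` with the
   own-direction factor WRITTEN `bmask N M S ν (zext N M S ν u)` (P3's def; definitional unfolding only), so that P5 applies P2's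
   `pairing_dir_le_starSite` to the `μ ≠ ν` summands and P3's `neumann_pairing_le` to the `ν` summand with no reshaping.

HONEST FRAMING (T4-DAG p. 1).  [folklore] finite lattice bookkeeping (identities and one sub-sum inequality); nothing printed is a hypothesis
or a conclusion; no NE2 statement is proved here (input of (P-gaffney) ⊂ (P-W) of the owner's `RegionLocalInjectedAssembly`); (P-W) / `hinjK`
/ W3 on boxes OPEN; NE2 (U1a) NOT proved; spine PROVED 0/9 unchanged; NOT [B9] (3.16)/(3.23)–(3.27) as printed; NOT infinite volume, NOT a
mass gap, NOT the Clay problem.  HONEST DEPENDENCY: continuum YM on T⁴ ⇐ BetaPertH ∧ nine spine estimates (0/9 proved); BetaPertH ⇐ (D1)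
∧ (D4) ∧ CAP+tail; G-an2-4 gates asym, D1 and NE2/3/4.  No `sorry`.
-/

noncomputable section

open scoped BigOperators ComplexConjugate Matrix
open Finset

namespace Summit.QuantumFields.BalabanUV.T4Continuum.StarCarrierNeumannHessian

open Literature.MathematicalPhysics.QuantumFieldTheory.Balaban1983to89.B5Prop11Plancherel (Tor fine unitVec)
open Literature.MathematicalPhysics.QuantumFieldTheory.Balaban1983to89.B5Prop11Lower (nsq nsq_nonneg star_dotProduct_self)
open Literature.MathematicalPhysics.QuantumFieldTheory.Balaban1983to89.B5Action121 (sdiff)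
open Literature.MathematicalPhysics.QuantumFieldTheory.Balaban1983to89.B5G183RateUnitTower (lev)
open Summit.QuantumFields.BalabanUV.T4Continuum
open Summit.QuantumFields.BalabanUV.T4Continuum.RegionGaugeFixedVector (starReg)
open Summit.QuantumFields.BalabanUV.T4Continuum.AlignedCarrierTrace (starSite)
open Summit.QuantumFields.BalabanUV.T4Continuum.RegionStarBoundaryCharges (AtMostOneNeighbour atMostOneNeighbour_of_isCoordBox)
open Summit.QuantumFields.BalabanUV.T4Continuum.RegionElectricSplitting (Wdir)
open Summit.QuantumFields.BalabanUV.T4Continuum.RegionGaugeResolventSplit (regionDeltaLoc)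
open Summit.QuantumFields.BalabanUV.T4Continuum.DirichletSubregionTowerOf (pidx JpR)
open Summit.QuantumFields.BalabanUV.T4Continuum.DirichletStarVectorTower (starP)
open Summit.QuantumFields.BalabanUV.T4Continuum.StarCarrierComponents (zext chi Pneu_mulVec Wdir_mulVec_apply_self JKs
  star_dotProduct_eq_sum_zext)
open Summit.QuantumFields.BalabanUV.T4Continuum.StarCarrierTwoLevelIdentity (chi_eq_ite_starSite first_order_identity_ite)
open Summit.QuantumFields.BalabanUV.T4Continuum.StarCarrierNeumannPairing (neuSt hessN bm bmask)
open Summit.QuantumFields.BalabanUV.T4Continuum.RegionElectricDictionary (sum_starSite_eq)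
open Summit.QuantumFields.BalabanUV.Beta.GAN24.DirichletBoxTwoLevel (IsCoordBox)
open Summit.QuantumFields.BalabanUV.Beta.GAN24.DirichletBoxPairing (Aop Fop)

variable {d : ℕ} (N R : ℕ) [NeZero N] [NeZero R] (M : Fin d → ℕ) [hM : ∀ μ, NeZero (M μ)] (S : Tor M → Prop) [DecidablePred S]

/-! ## §1 P3's Neumann stencil of a zero-extended component is the `ν`-row of `W_ν` -/

/-- **ON THE FINE STAR CARRIER, P3's NEUMANN STENCIL OF `zext ν v` IS THE `(x, ν)` ENTRY OF `W_ν v`** (`AtMostOneNeighbour` at the fine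
level): `neuSt N R M S ν (zext (R·N) M S ν v) x = (Wdir (R·N) M S ν *ᵥ v) ⟨(x, ν), hx⟩`. [folklore] -/
theorem neuSt_zext_eq (hH : AtMostOneNeighbour (R * N) M S) (ν : Fin d) (v : {b // starReg (R * N) M S b} → ℂ)
    {x : Tor (fine (R * N) M)} (hx : starSite (R * N) M S ν x) :
    neuSt N R M S ν (zext (R * N) M S ν v) x = (Wdir (R * N) M S ν *ᵥ v) ⟨(x, ν), hx⟩ := by
  rw [Wdir_mulVec_apply_self (R * N) M S hH ν v hx, Pneu_mulVec]
  unfold neuSt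
  rw [Complex.conj_natCast, chi_eq_ite_starSite (R * N) M S hH ν x,
    chi_eq_ite_starSite (R * N) M S hH ν (x - unitVec (fine (R * N) M) ν), sub_add_cancel]
  have hx' : starSite (R * N) M S ν x := hx
  by_cases hp : starSite (R * N) M S ν (x + unitVec (fine (R * N) M) ν) <;>
    by_cases hm : starSite (R * N) M S ν (x - unitVec (fine (R * N) M) ν) <;>
    simp only [hp, hm, hx', and_self, and_true, and_false, if_true, if_false] <;> ring

/-! ## §2 `hessN` of a zero-extended component is the `ν`-row part of `‖W_ν v‖²` -/

/-- **`hessN (zext ν v) = Σ_{b.2 = ν} ‖(W_ν v) b‖²`** (`AtMostOneNeighbour` at the fine level). [folklore] -/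
theorem hessN_zext_eq (hH : AtMostOneNeighbour (R * N) M S) (ν : Fin d) (v : {b // starReg (R * N) M S b} → ℂ) :
    hessN N R M S ν (zext (R * N) M S ν v)
      = ∑ b : {b // starReg (R * N) M S b}, (if b.1.2 = ν then ‖(Wdir (R * N) M S ν *ᵥ v) b‖ ^ 2 else 0) := by
  -- the row density as a function on `Tor × Fin d`
  set g : Tor (fine (R * N) M) × Fin d → ℝ :=
    fun c => if h : starReg (R * N) M S c then ‖(Wdir (R * N) M S ν *ᵥ v) ⟨c, h⟩‖ ^ 2 else 0 with hg
  have h1 : hessN N R M S ν (zext (R * N) M S ν v) = ∑ x ∈ univ.filter (starSite (R * N) M S ν), g (x, ν) := by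
    unfold hessN
    refine Finset.sum_congr rfl fun x hx => ?_
    have hx' : starSite (R * N) M S ν x := (Finset.mem_filter.mp hx).2
    rw [neuSt_zext_eq N R M S hH ν v hx', hg]
    simp only [dif_pos (show starReg (R * N) M S (x, ν) from hx')]
  rw [h1, sum_starSite_eq (R * N) M S ν g]
  refine Finset.sum_congr rfl fun b _ => ?_
  by_cases hb : b.1.2 = ν
  · rw [if_pos hb, if_pos hb, hg]
    simp only [dif_pos b.2]
  · rw [if_neg hb, if_neg hb]

/-- **THE NEUMANN HESSIAN JUNCTION** (item (iii) of leaf-03-g8's l.23066): `hessN N R M S ν (zext ν v) ≤ nsq (Wdir (R·N) M S ν *ᵥ v)`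
(`AtMostOneNeighbour` at the fine level). [folklore] -/
theorem hessN_zext_le (hH : AtMostOneNeighbour (R * N) M S) (ν : Fin d) (v : {b // starReg (R * N) M S b} → ℂ) :
    hessN N R M S ν (zext (R * N) M S ν v) ≤ nsq (Wdir (R * N) M S ν *ᵥ v) := by
  rw [hessN_zext_eq N R M S hH ν v, nsq]
  refine Finset.sum_le_sum fun b _ => ?_
  split_ifs
  · exact le_rfl
  · positivity

/-- the same on a product region at every fine level `R·N ≥ 2`. [folklore] -/
theorem hessN_zext_le_box (hS : IsCoordBox M S) (hRN : 2 ≤ R * N) (ν : Fin d) (v : {b // starReg (R * N) M S b} → ℂ) :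
    hessN N R M S ν (zext (R * N) M S ν v) ≤ nsq (Wdir (R * N) M S ν *ᵥ v) :=
  hessN_zext_le N R M S (atMostOneNeighbour_of_isCoordBox (R * N) M S hRN hS) ν v

/-- summed over the components: `Σ_ν hessN (zext ν v) ≤ Σ_ν nsq (Wdir ν v)` — the (R-loc) Hessian of leaf-02-g8's `hRH_box`. [folklore] -/
theorem sum_hessN_zext_le (hH : AtMostOneNeighbour (R * N) M S) (v : {b // starReg (R * N) M S b} → ℂ) :
    ∑ ν, hessN N R M S ν (zext (R * N) M S ν v) ≤ ∑ ν, nsq (Wdir (R * N) M S ν *ᵥ v) :=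
  Finset.sum_le_sum fun ν _ => hessN_zext_le N R M S hH ν v

/-! ## §2b The ℓ²-mass of the components: `Σ_ν ‖z_ν‖² = ‖v‖²` -/

/-- **`Σ_ν nsq (zext ν v) = nsq v`** (any region, any level): the star bonds are the disjoint union over `ν` of the carriers `T_ν`
(P4a's `star_dotProduct_eq_sum_zext` at `a = b = v`). [folklore] -/
theorem sum_nsq_zext_eq (n : ℕ) [NeZero n] (v : {b // starReg n M S b} → ℂ) : ∑ ν, nsq (zext n M S ν v) = nsq v := by
  have h := star_dotProduct_eq_sum_zext n M S v v
  rw [star_dotProduct_self] at h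
  simp only [star_dotProduct_self] at h
  rw [← Complex.ofReal_sum] at h
  exact (Complex.ofReal_injective h).symm

/-- hence **`nsq (zext ν v) ≤ nsq v`** for every component (item (iv) of l.23066, the `2·nsq z′` summand of P5a's `Bf`). [folklore] -/
theorem nsq_zext_le (n : ℕ) [NeZero n] (ν : Fin d) (v : {b // starReg n M S b} → ℂ) : nsq (zext n M S ν v) ≤ nsq v := by
  rw [← sum_nsq_zext_eq M S n v]
  exact Finset.single_le_sum (fun μ _ => nsq_nonneg (zext n M S μ v)) (Finset.mem_univ ν)

/-! ## §3 P4b's first-order identity in P3's `bmask` letters -/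

/-- **THE FIRST-ORDER TWO-LEVEL IDENTITY WITH THE OWN-DIRECTION FACTOR WRITTEN `bmask`** (product region, `N ≥ 2`): P4b's
`first_order_identity_ite`, the `ν` summand's right factor being P3's `bmask N M S ν (zext N M S ν u)` by unfolding `bmask`/`bm`. [folklore] -/
theorem first_order_identity_bmask (hS : IsCoordBox M S) (hN : 2 ≤ N) (u : {b // starReg N M S b} → ℂ)
    (v : {b // starReg (R * N) M S b} → ℂ) :
    star v ⬝ᵥ ((JKs N R M S * regionDeltaLoc N M 0 S - regionDeltaLoc (R * N) M 0 S * JKs N R M S) *ᵥ u)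
      = ∑ ν, ((∑ μ ∈ univ.erase ν, star ((Aop N R M μ - Fop N R M μ) *ᵥ zext (R * N) M S ν v)
              ⬝ᵥ (sdiff (fine N M) (N : ℂ) μ *ᵥ zext N M S ν u))
          + star ((Aop N R M ν - Fop N R M ν) *ᵥ zext (R * N) M S ν v) ⬝ᵥ bmask N M S ν (zext N M S ν u)) := by
  rw [first_order_identity_ite N R M S hS hN u v]
  rfl

/-- the same along the tower (`N = lev L k ≥ 2`, `R = L`; `JpR L M (starP L M S) k = JKs (lev L k) L M S` by `rfl`). [folklore] -/
theorem first_order_identity_lev_bmask (L : ℕ) [NeZero L] (hS : IsCoordBox M S) (k : ℕ) (hN : 2 ≤ lev L k)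
    (u : pidx L M (starP L M S) k → ℂ) (v : pidx L M (starP L M S) (k + 1) → ℂ) :
    star v ⬝ᵥ ((JpR L M (starP L M S) k * regionDeltaLoc (lev L k) M 0 S - regionDeltaLoc (lev L (k + 1)) M 0 S * JpR L M (starP L M S) k) *ᵥ u)
      = ∑ ν, ((∑ μ ∈ univ.erase ν, star ((Aop (lev L k) L M μ - Fop (lev L k) L M μ) *ᵥ zext (lev L (k + 1)) M S ν v)
              ⬝ᵥ (sdiff (fine (lev L k) M) ((lev L k : ℕ) : ℂ) μ *ᵥ zext (lev L k) M S ν u))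
          + star ((Aop (lev L k) L M ν - Fop (lev L k) L M ν) *ᵥ zext (lev L (k + 1)) M S ν v)
              ⬝ᵥ bmask (lev L k) M S ν (zext (lev L k) M S ν u)) :=
  first_order_identity_bmask (lev L k) L M S hS hN u v

end Summit.QuantumFields.BalabanUV.T4Continuum.StarCarrierNeumannHessian

end
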